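import Summits.CriticalPhenomena.PercolationContinuityZ3.Theorems.FK.PressureElementaryBounds
import Mathlib.Analysis.SpecialFunctions.BinaryEntropy
import HarnessLib

/-!
# THE GIBBS VARIATIONAL INEQUALITY AND THE MEAN-FIELD (CURIE–WEISS) LOWER BOUND ON THE ISING PRESSURE:
# `ψ(β,h) ≥ s(t) + βd t² + βh t` for every trial magnetisation `t ∈ [−1,1]`, `s(t) = binEntropy((1+t)/2)`
# (Friedli–Velenik 2017, §2.5 (Curie–Weiss) and §6.9 (variational principle); Griffiths 1972, §V.C; Ruelle 1969, §2.6)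

Claimed R42 (8)(c) in the cell INBOX at 2026-08-29T04:59:39Z by fkp-10a gen 358 (NEW CLAIM #3 of the gen), addressed to coordinator fk-4 gen 292 (seated 04:05Z 2026-08-29 by l.8710; R166 / R167 in force); lineage row FO-10a-g358m (self-suggested), package g358-meanfield, label MF-A.
Helper file of the `fk-continuity` build cell (bschramm lane; `--supports stmt-CriticalPhenomena-4575`); builds on
p205010 (kernel theorem, internal audit signed; external expert review pending). No definitions, no named facts, no
sorries; standard axioms. UNCONDITIONAL (nearest-neighbour Ising model on `ℤ^d`, every `d`, ALL real `β`, `h`;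
finite-volume part on any locally finite graph, free boundary condition).

* **`sum_mul_sub_sum_mul_log_le_log_sum_exp`** — THE GIBBS VARIATIONAL INEQUALITY on a finite set:
  `Σᵢ pᵢ aᵢ − Σᵢ pᵢ log pᵢ ≤ log Σᵢ e^{aᵢ}` for every probability vector `p` (Jensen for `log`); equality iff `p` is the
  Gibbs distribution (not needed here);
* the product ("mean-field") trial state on `Λ → {±1}` with magnetisation `t`: `Π_x (1 + t τ_x)/2` — its
  normalisation, one-point function `t`, two-point function `t²` (distinct sites) and entropy
  `−|Λ| binEntropy((1+t)/2)` (`sum_prodWeight_eq_one`, `sum_prodWeight_mul_coe`, `sum_prodWeight_mul_coe_mul_coe`,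
  `sum_prodWeight_mul_log_prodWeight`);
* **`card_mul_binEntropy_add_le_log_isingPartitionFunction_free`** — for every finite graph piece and `t ∈ [−1,1]`:
  `|Λ| binEntropy((1+t)/2) + β|E_Λ| t² + βh|Λ| t ≤ log Z^∅_{Λ;β,h}`;
* **`binEntropy_add_le_pressure`** — `binEntropy((1+t)/2) + βd t² + βh t ≤ ψ(β,h)` for all `t ∈ [−1,1]` and all real
  `β, h`: the CURIE–WEISS (mean-field) pressure with coordination number `2d` bounds the Ising pressure from below
  (at `t = 0`: `log 2 ≤ ψ`; at `t = ±1`: `β(d + |h|) ≤ ψ` — the two elementary bounds of the tree are the endpoints of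
  this one-parameter family); `iSup_binEntropy_add_le_pressure` — the supremum form.

## References

* S. Friedli, Y. Velenik, *Statistical Mechanics of Lattice Systems*, CUP (2017), §2.5 (the Curie–Weiss pressure
  `max_m [s(m) + βdm² + βhm]`), §6.9 (the variational principle; Gibbs' inequality in finite volume). [FriedliVelenik2017]
* R. B. Griffiths, *Rigorous results and theorems*, in Phase Transitions and Critical Phenomena 1 (1972), §V.C
  (the Peierls–Bogoliubov inequality `log Tr e^{A+B} ≥ log Tr e^{A} + ⟨B⟩_A`). [Griffiths1972]
* D. Ruelle, *Statistical Mechanics: Rigorous Results*, Benjamin (1969), §2.6. [Ruelle1969]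
-/

noncomputable section

namespace Summit.CriticalPhenomena.PercolationContinuityZ3.Theorems.FK

namespace IsingPressure

open MeasureTheory Filter Topology Finset Set
open Literature.Probability.LatticeModels

variable {d : ℕ}

/-! ### The Gibbs variational inequality on a finite set -/

/-- **Gibbs' variational inequality**: for a probability vector `p` on a finite nonempty type and any `a`,
`Σᵢ pᵢ aᵢ − Σᵢ pᵢ log pᵢ ≤ log Σᵢ exp aᵢ` (Jensen's inequality for the concave `log` with weights `pᵢ` at the points
`e^{aᵢ}/pᵢ`). [cite: FriedliVelenik2017, §6.9; Griffiths1972, §V.C] -/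
theorem sum_mul_sub_sum_mul_log_le_log_sum_exp {ι : Type*} [Fintype ι] (p a : ι → ℝ) (hp0 : ∀ i, 0 ≤ p i)
    (hp1 : ∑ i, p i = 1) :
    ∑ i, p i * a i - ∑ i, p i * Real.log (p i) ≤ Real.log (∑ i, Real.exp (a i)) := by
  classical
  -- points `x i = exp (a i) / p i` (or `1` when `p i = 0`)
  set x : ι → ℝ := fun i => if p i = 0 then 1 else Real.exp (a i) / p i with hx
  have hxpos : ∀ i, 0 < x i := fun i => by
    by_cases hi : p i = 0
    · simp [hx, hi]
    · simp only [hx, hi, if_false]; exact div_pos (Real.exp_pos _) ((hp0 i).lt_of_ne' hi)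
  -- Jensen for `log` on `(0, ∞)`
  have hJ := (strictConcaveOn_log_Ioi.concaveOn).le_map_sum (t := Finset.univ) (w := p) (p := x)
    (fun i _ => hp0 i) hp1 (fun i _ => mem_Ioi.2 (hxpos i))
  simp only [smul_eq_mul] at hJ
  -- left side: `Σ p i log (x i) = Σ p i a i − Σ p i log p i`
  have hleft : ∑ i, p i * Real.log (x i) = ∑ i, p i * a i - ∑ i, p i * Real.log (p i) := by
    rw [← sum_sub_distrib]
    refine sum_congr rfl fun i _ => ?_
    by_cases hi : p i = 0
    · simp [hi]
    · simp only [hx, hi, if_false]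
      rw [Real.log_div (Real.exp_pos _).ne' hi, Real.log_exp]; ring
  -- right side: `Σ p i x i ≤ Σ exp (a i)`
  have hright : ∑ i, p i * x i ≤ ∑ i, Real.exp (a i) := by
    refine sum_le_sum fun i _ => ?_
    by_cases hi : p i = 0
    · simp [hi, (Real.exp_pos _).le]
    · simp only [hx, hi, if_false]; rw [mul_div_cancel₀ _ hi]
  have hpos : 0 < ∑ i, p i * x i := by
    -- some `p i > 0` since they sum to `1`
    obtain ⟨i, -, hi⟩ : ∃ i ∈ (Finset.univ : Finset ι), 0 < p i := by
      by_contra hne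
      push Not at hne
      have : ∑ i, p i ≤ 0 := sum_nonpos fun i _ => hne i (mem_univ i)
      linarith
    exact lt_of_lt_of_le (mul_pos hi (hxpos i)) (single_le_sum (f := fun i => p i * x i)
      (fun j _ => mul_nonneg (hp0 j) (hxpos j).le) (mem_univ i))
  calc ∑ i, p i * a i - ∑ i, p i * Real.log (p i) = ∑ i, p i * Real.log (x i) := hleft.symm
    _ ≤ Real.log (∑ i, p i * x i) := hJ
    _ ≤ Real.log (∑ i, Real.exp (a i)) := Real.log_le_log hpos hright

/-! ### The product trial state with magnetisation `t` -/

section Product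

variable {V : Type*} [DecidableEq V]

/-- **Factorisation of sums over `Λ → {±1}`**: `Σ_τ Π_x g x (τ x) = Π_x (g x 1 + g x (−1))`. [folklore] -/
theorem sum_prod_eq_prod_add (Λ : Finset V) (g : Λ → ℤˣ → ℝ) :
    ∑ τ : Λ → ℤˣ, ∏ x, g x (τ x) = ∏ x : Λ, (g x 1 + g x (-1)) := by
  classical
  rw [← Fintype.piFinset_univ, ← Finset.prod_univ_sum (fun _ => (univ : Finset ℤˣ)) g]
  refine prod_congr rfl fun x _ => ?_
  rw [UnitsInt.univ, sum_pair (by decide)]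

/-- The weights `q_t(1) + q_t(−1) = 1` of the one-site trial state, `q_t(u) = (1 + t u)/2`. [folklore] -/
theorem one_add_mul_div_two_add (t : ℝ) :
    (1 + t * (((1 : ℤˣ) : ℤ) : ℝ)) / 2 + (1 + t * (((-1 : ℤˣ) : ℤ) : ℝ)) / 2 = 1 := by
  simp; ring

/-- **The product trial state is normalised**: `Σ_τ Π_x (1 + t τ_x)/2 = 1`. [cite: FriedliVelenik2017, §2.5] -/
theorem sum_prodWeight_eq_one (Λ : Finset V) (t : ℝ) :
    ∑ τ : Λ → ℤˣ, ∏ x : Λ, (1 + t * ((τ x : ℤ) : ℝ)) / 2 = 1 := by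
  rw [sum_prod_eq_prod_add Λ (fun _ u => (1 + t * ((u : ℤ) : ℝ)) / 2)]
  simp only [one_add_mul_div_two_add, prod_const_one]

/-- **Marked factorisation**: for a site `x₀ ∈ Λ` and `f : {±1} → ℝ`,
`Σ_τ (Π_x (1 + t τ_x)/2) f(τ_{x₀}) = ((1+t)/2) f(1) + ((1−t)/2) f(−1)`. [folklore] -/
theorem sum_prodWeight_mul_apply (Λ : Finset V) (t : ℝ) (x₀ : Λ) (f : ℤˣ → ℝ) :
    ∑ τ : Λ → ℤˣ, (∏ x : Λ, (1 + t * ((τ x : ℤ) : ℝ)) / 2) * f (τ x₀) =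
      (1 + t) / 2 * f 1 + (1 - t) / 2 * f (-1) := by
  classical
  have hsplit : ∀ τ : Λ → ℤˣ, (∏ x : Λ, (1 + t * ((τ x : ℤ) : ℝ)) / 2) * f (τ x₀) =
      ∏ x : Λ, ((1 + t * ((τ x : ℤ) : ℝ)) / 2 * if x = x₀ then f (τ x) else 1) := by
    intro τ
    rw [prod_mul_distrib, prod_ite_eq' univ x₀ (fun x => f (τ x))]
    simp
  simp_rw [hsplit]
  rw [sum_prod_eq_prod_add Λ (fun x u => (1 + t * ((u : ℤ) : ℝ)) / 2 * if x = x₀ then f u else 1)]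
  rw [← prod_erase_mul univ _ (mem_univ x₀)]
  simp only [if_true]
  rw [prod_congr rfl (fun x hx => by rw [if_neg (ne_of_mem_erase hx), if_neg (ne_of_mem_erase hx)])]
  simp only [mul_one, one_add_mul_div_two_add, prod_const_one, one_mul]
  push_cast
  ring

/-- **The one-point function of the trial state is `t`**: `Σ_τ (Π_x (1 + t τ_x)/2) τ_{x₀} = t`.
[cite: FriedliVelenik2017, §2.5] -/
theorem sum_prodWeight_mul_coe (Λ : Finset V) (t : ℝ) (x₀ : Λ) :
    ∑ τ : Λ → ℤˣ, (∏ x : Λ, (1 + t * ((τ x : ℤ) : ℝ)) / 2) * ((τ x₀ : ℤ) : ℝ) = t := by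
  rw [sum_prodWeight_mul_apply Λ t x₀ (fun u => ((u : ℤ) : ℝ))]
  push_cast; ring

/-- **Doubly marked factorisation**: for distinct sites `x₀ ≠ y₀` of `Λ`,
`Σ_τ (Π_x (1 + t τ_x)/2) τ_{x₀} τ_{y₀} = t²`. [cite: FriedliVelenik2017, §2.5] -/
theorem sum_prodWeight_mul_coe_mul_coe (Λ : Finset V) (t : ℝ) {x₀ y₀ : Λ} (hxy : x₀ ≠ y₀) :
    ∑ τ : Λ → ℤˣ, (∏ x : Λ, (1 + t * ((τ x : ℤ) : ℝ)) / 2) * (((τ x₀ : ℤ) : ℝ) * ((τ y₀ : ℤ) : ℝ)) = t ^ 2 := by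
  classical
  have hsplit : ∀ τ : Λ → ℤˣ, (∏ x : Λ, (1 + t * ((τ x : ℤ) : ℝ)) / 2) * (((τ x₀ : ℤ) : ℝ) * ((τ y₀ : ℤ) : ℝ)) =
      ∏ x : Λ, ((1 + t * ((τ x : ℤ) : ℝ)) / 2 * ((if x = x₀ then ((τ x : ℤ) : ℝ) else 1) *
        (if x = y₀ then ((τ x : ℤ) : ℝ) else 1))) := by
    intro τ
    rw [prod_mul_distrib, prod_mul_distrib, prod_ite_eq' univ x₀ (fun x => ((τ x : ℤ) : ℝ)),
      prod_ite_eq' univ y₀ (fun x => ((τ x : ℤ) : ℝ))]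
    simp
  simp_rw [hsplit]
  rw [sum_prod_eq_prod_add Λ (fun x u => (1 + t * ((u : ℤ) : ℝ)) / 2 *
    ((if x = x₀ then ((u : ℤ) : ℝ) else 1) * (if x = y₀ then ((u : ℤ) : ℝ) else 1)))]
  -- split off the two marked factors
  rw [← prod_erase_mul univ _ (mem_univ x₀), ← prod_erase_mul (univ.erase x₀) _ (mem_erase.2 ⟨hxy.symm, mem_univ y₀⟩)]
  have hrest : ∀ x ∈ (univ.erase x₀).erase y₀, ((1 + t * (((1 : ℤˣ) : ℤ) : ℝ)) / 2 *
      ((if x = x₀ then (((1 : ℤˣ) : ℤ) : ℝ) else 1) * (if x = y₀ then (((1 : ℤˣ) : ℤ) : ℝ) else 1)) +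
      (1 + t * (((-1 : ℤˣ) : ℤ) : ℝ)) / 2 *
      ((if x = x₀ then (((-1 : ℤˣ) : ℤ) : ℝ) else 1) * (if x = y₀ then (((-1 : ℤˣ) : ℤ) : ℝ) else 1))) = 1 := by
    intro x hx
    have hx1 : x ≠ y₀ := ne_of_mem_erase hx
    have hx2 : x ≠ x₀ := ne_of_mem_erase (mem_of_mem_erase hx)
    simp only [hx1, hx2, if_false, mul_one]
    exact one_add_mul_div_two_add t
  rw [prod_congr rfl hrest, prod_const_one, one_mul]
  simp only [if_true, hxy.symm, hxy, if_false, mul_one, one_mul]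
  push_cast; ring

/-- **The entropy of the trial state**: `Σ_τ p_t(τ) log p_t(τ) = −|Λ| binEntropy((1+t)/2)` for `t ∈ [−1,1]`,
`p_t(τ) = Π_x (1 + t τ_x)/2`. [cite: FriedliVelenik2017, §2.5] -/
theorem sum_prodWeight_mul_log_prodWeight (Λ : Finset V) {t : ℝ} (ht : t ∈ Icc (-1 : ℝ) 1) :
    ∑ τ : Λ → ℤˣ, (∏ x : Λ, (1 + t * ((τ x : ℤ) : ℝ)) / 2) * Real.log (∏ x : Λ, (1 + t * ((τ x : ℤ) : ℝ)) / 2) =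
      -(#Λ * Real.binEntropy ((1 + t) / 2)) := by
  classical
  -- the factors are nonnegative
  have hq : ∀ (τ : Λ → ℤˣ) (x : Λ), 0 ≤ (1 + t * ((τ x : ℤ) : ℝ)) / 2 := by
    intro τ x
    rcases Int.units_eq_one_or (τ x) with h | h <;> simp [h] <;> linarith [ht.1, ht.2]
  -- `log Π = Σ log` (with `log 0 = 0` the identity holds even when some factor vanishes, by cases)
  have hlog : ∀ τ : Λ → ℤˣ, (∏ x : Λ, (1 + t * ((τ x : ℤ) : ℝ)) / 2) *
      Real.log (∏ x : Λ, (1 + t * ((τ x : ℤ) : ℝ)) / 2) =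
      ∑ x₀ : Λ, (∏ x : Λ, (1 + t * ((τ x : ℤ) : ℝ)) / 2) * Real.log ((1 + t * ((τ x₀ : ℤ) : ℝ)) / 2) := by
    intro τ
    by_cases h0 : ∃ x : Λ, (1 + t * ((τ x : ℤ) : ℝ)) / 2 = 0
    · obtain ⟨x, hx⟩ := h0
      have hz : ∏ x : Λ, (1 + t * ((τ x : ℤ) : ℝ)) / 2 = 0 := prod_eq_zero (mem_univ x) hx
      rw [hz]; simp
    · push Not at h0
      rw [Real.log_prod (s := univ) (fun x _ => h0 x), mul_sum]
  simp_rw [hlog]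
  rw [sum_comm]
  have hx : ∀ x₀ : Λ, ∑ τ : Λ → ℤˣ, (∏ x : Λ, (1 + t * ((τ x : ℤ) : ℝ)) / 2) *
      Real.log ((1 + t * ((τ x₀ : ℤ) : ℝ)) / 2) = -Real.binEntropy ((1 + t) / 2) := by
    intro x₀
    rw [sum_prodWeight_mul_apply Λ t x₀ (fun u => Real.log ((1 + t * ((u : ℤ) : ℝ)) / 2)), Real.binEntropy,
      Real.log_inv, Real.log_inv]
    have e1 : 1 - (1 + t) / 2 = (1 - t) / 2 := by ring
    have e2 : (1 + t * (((1 : ℤˣ) : ℤ) : ℝ)) / 2 = (1 + t) / 2 := by push_cast; ring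
    have e3 : (1 + t * (((-1 : ℤˣ) : ℤ) : ℝ)) / 2 = (1 - t) / 2 := by push_cast; ring
    rw [e1, e2, e3]
    ring
  rw [sum_congr rfl fun x₀ _ => hx x₀, sum_const, card_univ, Fintype.card_coe, nsmul_eq_mul]
  ring

end Product

/-! ### The mean-field lower bound in finite volume -/

section FiniteVolume

variable {V : Type*} (G : SimpleGraph V) [DecidableEq V] [G.LocallyFinite]

/-- **THE MEAN-FIELD LOWER BOUND IN FINITE VOLUME**: for every finite graph piece `(Λ, E_Λ)`, all real `β, h` and every
trial magnetisation `t ∈ [−1,1]`,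
`|Λ| binEntropy((1+t)/2) + β |E_Λ| t² + βh |Λ| t ≤ log Z^∅_{Λ;β,h}` (the Gibbs variational inequality with the product
state of magnetisation `t`: energy `β|E_Λ|t² + βh|Λ|t`, entropy `|Λ| binEntropy((1+t)/2)`).
[cite: FriedliVelenik2017, §2.5 and §6.9; Griffiths1972, §V.C] -/
theorem card_mul_binEntropy_add_le_log_isingPartitionFunction_free (Λ : Finset V) (β h : ℝ) {t : ℝ}
    (ht : t ∈ Icc (-1 : ℝ) 1) :
    #Λ * Real.binEntropy ((1 + t) / 2) + β * #(edgesIn G Λ) * t ^ 2 + β * h * #Λ * t ≤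
      Real.log (isingPartitionFunction G Λ β h .free) := by
  classical
  set p : (Λ → ℤˣ) → ℝ := fun τ => ∏ x : Λ, (1 + t * ((τ x : ℤ) : ℝ)) / 2 with hp
  have hp0 : ∀ τ, 0 ≤ p τ := fun τ => prod_nonneg fun x _ => by
    rcases Int.units_eq_one_or (τ x) with h' | h' <;> simp [h'] <;> linarith [ht.1, ht.2]
  have hp1 : ∑ τ, p τ = 1 := sum_prodWeight_eq_one Λ t
  have hG := sum_mul_sub_sum_mul_log_le_log_sum_exp p
    (fun τ => -β * isingHamiltonian G Λ h .free (glue Λ τ .free)) hp0 hp1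
  rw [← isingPartitionFunction_eq_sum_exp] at hG
  -- the energy of the trial state
  have hspin : ∀ (τ : Λ → ℤˣ), ∑ x ∈ Λ, spinAt x (glue Λ τ .free) = ∑ x : Λ, ((τ x : ℤ) : ℝ) := by
    intro τ
    rw [← sum_coe_sort Λ]
    exact sum_congr rfl fun x _ => by simp [spinAt]
  have hfield : ∑ τ, p τ * ∑ x ∈ Λ, spinAt x (glue Λ τ .free) = #Λ * t := by
    simp_rw [hspin, mul_sum]
    rw [sum_comm]
    simp_rw [show ∀ (x : Λ) (τ : Λ → ℤˣ), p τ * ((τ x : ℤ) : ℝ) = (∏ y : Λ, (1 + t * ((τ y : ℤ) : ℝ)) / 2) *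
      ((τ x : ℤ) : ℝ) from fun x τ => rfl, sum_prodWeight_mul_coe]
    rw [sum_const, card_univ, Fintype.card_coe, nsmul_eq_mul]
  have hbond : ∑ τ, p τ * ∑ e ∈ edgesIn G Λ, bondSpin (glue Λ τ .free) e = #(edgesIn G Λ) * t ^ 2 := by
    simp_rw [mul_sum]
    rw [sum_comm]
    have he : ∀ e ∈ edgesIn G Λ, ∑ τ : Λ → ℤˣ, p τ * bondSpin (glue Λ τ .free) e = t ^ 2 := by
      intro e he
      induction e using Sym2.ind with
      | _ x y =>
        have hx : x ∈ Λ := (mem_edgesIn_iff.1 he).2 x (Sym2.mem_mk_left x y)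
        have hy : y ∈ Λ := (mem_edgesIn_iff.1 he).2 y (Sym2.mem_mk_right x y)
        have hxy : (⟨x, hx⟩ : Λ) ≠ ⟨y, hy⟩ := fun hh => G.ne_of_adj (mem_edgesIn_iff.1 he).1 (Subtype.ext_iff.1 hh)
        have hb : ∀ τ : Λ → ℤˣ, bondSpin (glue Λ τ .free) s(x, y) = ((τ ⟨x, hx⟩ : ℤ) : ℝ) * ((τ ⟨y, hy⟩ : ℤ) : ℝ) :=
          fun τ => by rw [bondSpin_mk, spinAt, spinAt, glue_apply_of_mem Λ τ .free hx, glue_apply_of_mem Λ τ .free hy]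
        simp_rw [hb]
        exact sum_prodWeight_mul_coe_mul_coe Λ t hxy
    rw [sum_congr rfl he, sum_const, nsmul_eq_mul]
  have henergy : ∑ τ, p τ * (-β * isingHamiltonian G Λ h .free (glue Λ τ .free)) =
      β * #(edgesIn G Λ) * t ^ 2 + β * h * #Λ * t := by
    have hH : ∀ τ, p τ * (-β * isingHamiltonian G Λ h .free (glue Λ τ .free)) =
        β * (p τ * ∑ e ∈ edgesIn G Λ, bondSpin (glue Λ τ .free) e) +
          β * h * (p τ * ∑ x ∈ Λ, spinAt x (glue Λ τ .free)) := by
      intro τ; unfold isingHamiltonian; rw [interactionEdges_free]; ring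
    simp_rw [hH]
    rw [sum_add_distrib, ← mul_sum, ← mul_sum, hbond, hfield]
    ring
  -- the entropy of the trial state
  have hent : ∑ τ, p τ * Real.log (p τ) = -(#Λ * Real.binEntropy ((1 + t) / 2)) :=
    sum_prodWeight_mul_log_prodWeight Λ ht
  rw [henergy, hent] at hG
  linarith

end FiniteVolume

/-! ### Infinite volume: the Curie–Weiss lower bound -/

/-- **THE MEAN-FIELD (CURIE–WEISS) LOWER BOUND ON THE ISING PRESSURE**: for all real `β, h` and every
`t ∈ [−1,1]`, `binEntropy((1+t)/2) + βd t² + βh t ≤ ψ(β,h)` — the Curie–Weiss pressure functional with coordination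
number `2d` lies below the true pressure (Gibbs variational principle with product states; `|E_{Λ_L}|/|Λ_L| → d`). At
`t = 0` this is `log 2 ≤ ψ`, at `t = ±1` it is `β(d ± h) ≤ ψ`. [cite: FriedliVelenik2017, §2.5 and §6.9; Griffiths1972, §V.C; Ruelle1969, §2.6] -/
theorem binEntropy_add_le_pressure (β h : ℝ) {t : ℝ} (ht : t ∈ Icc (-1 : ℝ) 1) :
    Real.binEntropy ((1 + t) / 2) + β * d * t ^ 2 + β * h * t ≤ pressure d β h := by
  have hlim : Tendsto (fun L : ℕ => pressureIn (zdGraph d) (box d L) β h .free) atTop (𝓝 (pressure d β h)) :=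
    hasBoxLimit_pressureIn_holds (d := d) β h .free
  have hlow : Tendsto (fun L : ℕ => Real.binEntropy ((1 + t) / 2) +
      β * (((#(edgesIn (zdGraph d) (box d L)) : ℝ) / #(box d L))) * t ^ 2 + β * h * t) atTop
      (𝓝 (Real.binEntropy ((1 + t) / 2) + β * d * t ^ 2 + β * h * t)) :=
    ((tendsto_const_nhds.add (((tendsto_card_edgesIn_box_div_card_box (d := d)).const_mul β).mul_const _)).add
      tendsto_const_nhds)
  refine le_of_tendsto_of_tendsto' hlow hlim fun L => ?_
  have hpos : (0 : ℝ) < #(box d L) := by exact_mod_cast (box_nonempty d L).card_pos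
  rw [pressureIn, le_div_iff₀ hpos]
  have h1 := card_mul_binEntropy_add_le_log_isingPartitionFunction_free (zdGraph d) (box d L) β h ht
  calc (Real.binEntropy ((1 + t) / 2) + β * ((#(edgesIn (zdGraph d) (box d L)) : ℝ) / #(box d L)) * t ^ 2 +
        β * h * t) * #(box d L)
      = #(box d L) * Real.binEntropy ((1 + t) / 2) + β * #(edgesIn (zdGraph d) (box d L)) * t ^ 2 +
          β * h * #(box d L) * t := by field_simp
    _ ≤ _ := h1

/-- **The supremum form**: `⨆_{t ∈ [−1,1]} [binEntropy((1+t)/2) + βd t² + βh t] ≤ ψ(β,h)` (all real `β, h`).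
[cite: FriedliVelenik2017, §2.5] -/
theorem iSup_binEntropy_add_le_pressure (β h : ℝ) :
    ⨆ t : Icc (-1 : ℝ) 1, (Real.binEntropy ((1 + (t : ℝ)) / 2) + β * d * (t : ℝ) ^ 2 + β * h * t) ≤ pressure d β h := by
  haveI : Nonempty (Icc (-1 : ℝ) 1) := ⟨⟨0, by norm_num, by norm_num⟩⟩
  exact ciSup_le fun t => binEntropy_add_le_pressure β h t.2

/-- **Above the naive mean-field threshold the bound beats `log 2`**: for `t ∈ (−1,1)`,
`log 2 + (βd − 1) t² ≤ ψ(β,0)` (from `binEntropy((1+t)/2) ≥ log 2 − t²`, i.e. `(1±t) log(1±t) ≤ (1±t)(±t)`); in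
particular `ψ(β,0) > log 2` as soon as `βd > 1`. (The sharp quadratic term `−t²/2`, giving the Curie–Weiss threshold
`2dβ > 1`, needs the second-order Taylor bound and is not pursued here.) [cite: FriedliVelenik2017, §2.5] -/
theorem log_two_add_le_pressure_zero_field (β : ℝ) {t : ℝ} (ht : t ∈ Ioo (-1 : ℝ) 1) :
    Real.log 2 + (β * d - 1) * t ^ 2 ≤ pressure d β 0 := by
  have ht' : t ∈ Icc (-1 : ℝ) 1 := ⟨ht.1.le, ht.2.le⟩
  have hmain := binEntropy_add_le_pressure (d := d) β 0 ht'
  rw [mul_zero, zero_mul, add_zero] at hmain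
  have h1t : 0 < 1 + t := by linarith [ht.1]
  have h1t' : 0 < 1 - t := by linarith [ht.2]
  -- `binEntropy((1+t)/2) = log 2 − [(1+t) log(1+t) + (1−t) log(1−t)]/2`
  have hbin : Real.binEntropy ((1 + t) / 2) =
      Real.log 2 - ((1 + t) * Real.log (1 + t) + (1 - t) * Real.log (1 - t)) / 2 := by
    rw [Real.binEntropy, Real.log_inv, Real.log_inv]
    have e1 : 1 - (1 + t) / 2 = (1 - t) / 2 := by ring
    rw [e1, Real.log_div h1t.ne' two_ne_zero, Real.log_div h1t'.ne' two_ne_zero]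
    ring
  -- `log y ≤ y − 1` at `y = 1 ± t`
  have hl1 : Real.log (1 + t) ≤ t := by have := Real.log_le_sub_one_of_pos h1t; linarith
  have hl2 : Real.log (1 - t) ≤ -t := by have := Real.log_le_sub_one_of_pos h1t'; linarith
  have hsum : (1 + t) * Real.log (1 + t) + (1 - t) * Real.log (1 - t) ≤ 2 * t ^ 2 := by
    nlinarith [mul_le_mul_of_nonneg_left hl1 h1t.le, mul_le_mul_of_nonneg_left hl2 h1t'.le]
  nlinarith [hbin, hsum, hmain]

/-- **`ψ(β,0) > log 2` whenever `βd > 1`** (a crude mean-field criterion; the entropy bound `log 2 ≤ ψ` is strict above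
the naive threshold). [cite: FriedliVelenik2017, §2.5] -/
theorem log_two_lt_pressure_zero_field {β : ℝ} (hβ : 1 < β * d) : Real.log 2 < pressure d β 0 := by
  have h := log_two_add_le_pressure_zero_field (d := d) β (t := 1 / 2) ⟨by norm_num, by norm_num⟩
  have hpos : 0 < (β * d - 1) * (1 / 2 : ℝ) ^ 2 := by nlinarith
  linarith

end IsingPressure

end Summit.CriticalPhenomena.PercolationContinuityZ3.Theorems.FK

end
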